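import Literature.Combinatorics.SimpleGraph.TreeAutomorphismFixedSubtree   -- ★ `TreeAutomorphism.forall_mem_support_eq_of_isAcyclic` (Serre *Trees* I §2.3)
import HarnessLib

/-!
# R90 · S6 «Ch. 14.1–14.5 stable trace formula» — WAVE 6 card W6-c: the fixed vertices of a tree automorphism are GEODESICALLY
# CONVEX (`Theorems/R90S6TreeFixedPointsConvex.lean`)

Cell `hodgecm-mathlib`, crux H413 (`stmt-HodgeConjecture-24833`), route of record `HCCMUnconditional`; programme R90-TF, section S6
(base `R90-C14`), seat R90-C14-p05 (g0); S6 WAVE 7 DEAL (R90-C14-plan (g2), 2026-09-04T23:08:14Z) «p05 → W6-a then W6-c», card W6-c of the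
sheet `R90/R90-C14-plan/g2/S6_wave6_targets.v1.R90-C14-plan-g2.lean` 82d8032ceb473274 :26–:28 (signature token-identical, `.Wave6` dropped;
AUDIT BOX S6#W6 CLEAN ×4, R90-C14-audit1 (g2) 23:00:23Z).  Helper lane `--supports stmt-HodgeConjecture-24833 --as helper`; ONE theorem (no
definition, no instance, no notation, no named fact, no `sorry`); imports = ★ `Literature.Combinatorics.SimpleGraph.TreeAutomorphismFixedSubtree`
(pure-Mathlib tree file) + HarnessLib.

THE MATHEMATICS [Serre1980Trees, I §2.3 Prop. 8, I.6.1; Meier2008, Lemma 3.50]: in a tree `G` the hypothesis `d(x, z) + d(z, y) = d(x, y)` says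
that the concatenation of a geodesic `x ⇝ z` with a geodesic `z ⇝ y` has length `d(x, y)`, hence is a PATH (Mathlib
`Walk.isPath_of_length_eq_dist`) through `z`; a path between two `φ`-fixed vertices is mapped by `φ` to a path with the same endpoints,
hence (uniqueness of paths in a tree) to itself, so it is fixed pointwise (★ `TreeAutomorphism.forall_mem_support_eq_of_isAcyclic`), and in
particular `φ z = z`.
HONEST LABEL: generic tree combinatorics for the E1-c (full-Hecke FL count on the `U(3)` Bruhat–Tits tree) assembly E1.3.9 — count-neutral
until consumed; proves no printed statement about unitary groups.  HC_CM is proved only modulo the 7 printed citations (2 remaining named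
inputs: hLiu418 = stmt-HodgeConjecture-24832, h413 = stmt-HodgeConjecture-24833) until rung 0 closes.
-/

set_option autoImplicit false
-- the mandated namespace repeats the single-problem summit's segment (`HodgeConjecture.HodgeConjecture`)
set_option linter.dupNamespace false

open SimpleGraph

namespace Summit.HodgeConjecture.HodgeConjecture.R90.S6

variable {V : Type*} (G : SimpleGraph V)

/-- **W6-c (the fixed-point set of a tree automorphism is geodesically convex)** [Serre1980Trees, I §2.3 Prop. 8, I.6.1; Meier2008,
Lemma 3.50]: in a tree, a vertex `z` on a geodesic between two `φ`-fixed vertices `x`, `y` (`d(x, z) + d(z, y) = d(x, y)`) is fixed —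
the geodesic `x ⇝ z ⇝ y` is the unique path from `x` to `y` and is mapped by `φ` to a path with the same endpoints, hence fixed pointwise
(★ `Literature.Combinatorics.SimpleGraph.TreeAutomorphism.forall_mem_support_eq_of_isAcyclic`).  (Sheet `S6_wave6_targets.v1` :26–:28
token-for-token.) [cite: Serre1980Trees, I §2.3 Prop. 8] [cite: Meier2008, Lemma 3.50] -/
theorem fixedPoints_convex_of_isTree (hG : G.IsTree) (φ : G ≃g G) {x y z : V} (hx : φ x = x) (hy : φ y = y)
    (hz : G.dist x z + G.dist z y = G.dist x y) : φ z = z := by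
  -- geodesics `x ⇝ z` and `z ⇝ y`
  obtain ⟨P, -, hPl⟩ := hG.connected.exists_path_of_dist x z
  obtain ⟨Q, -, hQl⟩ := hG.connected.exists_path_of_dist z y
  -- their concatenation has length `d(x, y)`, so it is a path (through `z`)
  have hlen : (P.append Q).length = G.dist x y := by rw [Walk.length_append, hPl, hQl, hz]
  have hpath : (P.append Q).IsPath := (P.append Q).isPath_of_length_eq_dist hlen
  have hzmem : z ∈ (P.append Q).support := (Walk.mem_support_append_iff P Q).2 (Or.inl P.end_mem_support)
  -- a path between two fixed vertices of a tree is fixed pointwise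
  exact Literature.Combinatorics.SimpleGraph.TreeAutomorphism.forall_mem_support_eq_of_isAcyclic hG.isAcyclic φ.toHom
    φ.injective hx hy hpath z hzmem

end Summit.HodgeConjecture.HodgeConjecture.R90.S6
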